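import Summits.CriticalPhenomena.PercolationContinuityZ3.Theorems.PercNearOneGluingNoHeavyQuantFarSunTKCount2
import Summits.CriticalPhenomena.PercolationContinuityZ3.Theorems.PercNearOneGluingNoHeavyQuantFarSunTKCount3
import Summits.CriticalPhenomena.PercolationContinuityZ3.Theorems.PercNearOneGluingNoHeavyQuantFarSunTKCount4
import Summits.CriticalPhenomena.PercolationContinuityZ3.Theorems.PercNearOneGluingNoHeavyQuantFarSunTKCount5
import HarnessLib

/-!
# FAR beyond trees: the certificate `T_K` — count-level core, NORMAL FORMS of the swap families

builds on p205010 (kernel theorem, internal audit signed; external expert review pending)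

Support file (`--supports stmt-CriticalPhenomena-4575`), seat `prim-cert-1` (gen 23); memo `prim-cert-1/FROM-prim-cert-1-g23-SUNFAR-ALL-K.md` §4.
Repackages `TK.gc_swap_nonneg_s0/s1` and the `TK.gc_ovl_nonneg_*` family (generated case analyses, `…TKCount2–5`) into the three
forms the set-level swap lemma (`…TKSwap`) consumes:
* `TK.gc_sep_nonneg` — separated swap, `s ≤ 1` interior splits: `0 ≤ Gc K c p q s e₀ e_K + Gc K c (p+q) 0 s e₀ e_K.qToP`;
* `TK.gc_ovl0_nonneg` — overlapping swap, no overlap split, `sb ≤ 1`: `0 ≤ Gc K (cb+cv) p q sb e₀ e_K + Gc K cb (cv+p+q) 0 sb e₀ e_K.qToP`;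
* `TK.gc_ovl1_nonneg` — overlapping swap, one overlap split:
  `0 ≤ Gc K (cb+cv) p q 1 e₀ e_K + (Gc K cb (cv+p+q) 0 0 e₀ e_K' + Gc K cb (cv+p+q+1) 0 0 e₀ e_K')`, `e_K' = e_K.qToP`.
No sorries; standard axioms.  Elementary [this work].
-/

namespace Summit.CriticalPhenomena.PercolationContinuityZ3.Theorems.HairyCycle

namespace TK

open Finset

variable {K : ℕ}

/-- **Separated swap, `s ≤ 1`** (from `gc_swap_nonneg_s0/s1`). [this work] -/
theorem gc_sep_nonneg (hK : 4 ≤ K) {c p q s : ℕ} (hs : s ≤ 1) {e0 eK : ESt} (h0 : e0.isLeft = true) (hK' : eK.isRight = true)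
    (h : c + p + q + s ≤ K - 2) (hpq0 : e0 = ESt.p → eK = ESt.q → c = 0) (hpq1 : s = 1 → ¬ (e0 = ESt.p ∧ eK = ESt.q)) :
    0 ≤ Gc K c p q s e0 eK + Gc K c (p + q) 0 s e0 eK.qToP := by
  interval_cases s
  · exact gc_swap_nonneg_s0 K c p q e0 eK hK h0 hK' (by omega) hpq0
  · exact gc_swap_nonneg_s1 K c p q e0 eK hK h0 hK' (by omega) (hpq1 rfl)

/-- **Overlapping swap, no overlap split, `sb ≤ 1`** (from `gc_ovl_nonneg_sb?_sv0_*`); when the overlap region carries no sure relay either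
(`cv = 0`) an extra interior position is available (`hdead`). [this work] -/
theorem gc_ovl0_nonneg (hK : 4 ≤ K) {cb cv p q sb : ℕ} (hs : sb ≤ 1) {e0 eK : ESt} (h0 : e0.isLeft = true) (hK' : eK.isRight = true)
    (h : cb + cv + p + q + sb ≤ K - 2) (hdead : cv = 0 → cb + p + q + sb + 1 ≤ K - 2)
    (hpq0 : e0 = ESt.p → eK = ESt.q → cb = 0) (hpq1 : sb = 1 → ¬ (e0 = ESt.p ∧ eK = ESt.q)) :
    0 ≤ Gc K (cb + cv) p q sb e0 eK + Gc K cb (cv + p + q) 0 sb e0 eK.qToP := by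
  interval_cases sb
  · rcases cv with _ | cv
    · have := gc_ovl_nonneg_sb0_sv0_cv0 K cb p q e0 eK hK h0 hK' (by have := hdead rfl; omega) hpq0
      simpa using this
    · have := gc_ovl_nonneg_sb0_sv0_cvpos K cb cv p q e0 eK hK h0 hK' (by omega) hpq0
      simpa using this
  · have hpq := hpq1 rfl
    rcases cv with _ | cv
    · have := gc_ovl_nonneg_sb1_sv0_cv0 K cb p q e0 eK hK h0 hK' (by have := hdead rfl; omega) hpq
      simpa using this
    · cases e0 with
      | q => exact absurd h0 (by decide)
      | n => simpa using gc_ovl_nonneg_sb1_sv0_cvpos_n K cb cv p q eK hK hK' (by omega)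
      | c => simpa using gc_ovl_nonneg_sb1_sv0_cvpos_c K cb cv p q eK hK hK' (by omega)
      | s => simpa using gc_ovl_nonneg_sb1_sv0_cvpos_s K cb cv p q eK hK hK' (by omega)
      | p => simpa using gc_ovl_nonneg_sb1_sv0_cvpos_p K cb cv p q eK hK hK' (by omega) (fun h => hpq ⟨rfl, h⟩)

/-- **Overlapping swap, one overlap split** (from `gc_ovl_nonneg_sb0_sv1_*`). [this work] -/
theorem gc_ovl1_nonneg (hK : 4 ≤ K) {cb cv p q : ℕ} {e0 eK : ESt} (h0 : e0.isLeft = true) (hK' : eK.isRight = true)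
    (h : cb + cv + p + q + 1 ≤ K - 2) (hpq0 : e0 = ESt.p → eK = ESt.q → cb = 0) :
    0 ≤ Gc K (cb + cv) p q 1 e0 eK + (Gc K cb (cv + p + q) 0 0 e0 eK.qToP + Gc K cb (cv + p + q + 1) 0 0 e0 eK.qToP) := by
  cases e0 with
  | q => exact absurd h0 (by decide)
  | n =>
    have := gc_ovl_nonneg_sb0_sv1_n K cb cv p q eK hK hK' (by omega)
    simpa [Finset.sum_range_succ] using this
  | c =>
    have := gc_ovl_nonneg_sb0_sv1_c K cb cv p q eK hK hK' (by omega)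
    simpa [Finset.sum_range_succ] using this
  | s =>
    have := gc_ovl_nonneg_sb0_sv1_s K cb cv p q eK hK hK' (by omega)
    simpa [Finset.sum_range_succ] using this
  | p =>
    have := gc_ovl_nonneg_sb0_sv1_p K cb cv p q eK hK hK' (by omega) (hpq0 rfl)
    simpa [Finset.sum_range_succ] using this

end TK

end Summit.CriticalPhenomena.PercolationContinuityZ3.Theorems.HairyCycle
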